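import Summits.KontsevichZagierPeriods.KontsevichZagierPeriods.Theses.FurushoPentagon
import Summits.KontsevichZagierPeriods.KontsevichZagierPeriods.Theorems.FurushoPentagonReducedPeriodRingDefs
import Literature.NumberTheory.Transcendental.KZCubicalCalculus
import Literature.NumberTheory.Transcendental.KZLogCalculusProofs

/-!
# `SectorToKernel`, line `effective-cube-surjection`, dimension-one rung: tameness after the power substitution (R3)

Let `g : ℝ → ℝ` be analytic at every point of `(0, 1]`, integrable on `(0, 1)`, and in Puiseux normal
form at `0⁺` with ramification index `e ≥ 1` on `(0, r)`: either `g (tᵉ) = 0` there, or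
`g (tᵉ) = tᵐ · G t` with `m ∈ ℤ`, `G` real-analytic on `(-r, r)` and `G 0 ≠ 0`. We prove that the
substituted integrand `t ↦ g (tᵉ) · e tᵉ⁻¹` (the Jacobian of the Kontsevich–Zagier change of variables
`s = tᵉ`) is the restriction to `(0, 1)` of a function `H` analytic on a neighbourhood of the closed
interval `[0, 1]` (`stub_tameAfterPowerSubst`).

Proof. By the one-variable change of variables formula
(`MeasureTheory.integrableOn_image_iff_integrableOn_abs_deriv_smul`) the substituted integrand is
integrable near `0`; in the second case it equals `e · t^(m+e-1) · G t` there, and since `|G| ≥ |G 0|/2`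
near `0` while `t ↦ t⁻¹` is not integrable at `0⁺`, the exponent `m + e - 1` is non-negative
(`tame_exponent_nonneg`). Hence `t ↦ e · t^(m+e-1) · G t` is analytic on `(-r, r)`; we glue it (resp. `0`
in the first case) below a cut point `0 < c < r` with the substituted integrand above `c`, the two
formulas agreeing on `(0, r)`; at every point of `[0, 1]` one of the two formulas is valid on a whole
neighbourhood, and the second one is analytic at each `t ∈ (0, 1]` because `g` is analytic at `tᵉ ∈ (0, 1]`.

References: folklore (real-analytic functions of one variable; Kontsevich–Zagier 2001, §1.2, rule (2)).
-/

noncomputable section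

namespace Summit.KontsevichZagierPeriods.FurushoPentagon.SectorToKernel

open Set MeasureTheory
open Literature.NumberTheory.Transcendental
open Literature.NumberTheory.Transcendental.KZ hiding cubicalSpan
open Summit.KontsevichZagierPeriods.KontsevichZagierPeriods.Theses.FurushoPentagon
open Summit.KontsevichZagierPeriods.FurushoPentagon.ReducedPeriodRing (unitCube cubicalGens cubicalSpan)

/-- `t ↦ t⁻¹` is not integrable on `(0, ρ)` for `ρ > 0`. [folklore] -/
theorem tame_not_integrableOn_inv {ρ : ℝ} (hρ : 0 < ρ) :
    ¬ IntegrableOn (fun x : ℝ => x⁻¹) (Set.Ioo (0:ℝ) ρ) := by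
  intro h
  have h' : IntervalIntegrable (fun x : ℝ => x⁻¹) volume 0 ρ := by
    rwa [intervalIntegrable_iff_integrableOn_Ioo_of_le hρ.le]
  simp [intervalIntegrable_inv_iff, hρ.ne, hρ.le] at h'

/-- Change of variables `s = tᵉ`: if `g` is integrable on `(0, 1)`, then the substituted integrand
`|e tᵉ⁻¹| • g (tᵉ)` is integrable on `(0, ρ)` for every `ρ ≤ 1`. [folklore] -/
theorem tame_integrableOn_subst {g : ℝ → ℝ} {e : ℕ} {ρ : ℝ}
    (hg : IntegrableOn g (Set.Ioo (0:ℝ) 1)) (he : 0 < e) (hρ₁ : ρ ≤ 1) :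
    IntegrableOn (fun t : ℝ => |(e : ℝ) * t ^ (e - 1)| • g (t ^ e)) (Set.Ioo (0:ℝ) ρ) := by
  have hs : MeasurableSet (Set.Ioo (0:ℝ) ρ) := measurableSet_Ioo
  have hf' : ∀ x ∈ Set.Ioo (0:ℝ) ρ,
      HasDerivWithinAt (fun t : ℝ => t ^ e) ((e : ℝ) * x ^ (e - 1)) (Set.Ioo (0:ℝ) ρ) x :=
    fun x _ => hasDerivWithinAt_pow e x
  have hinj : Set.InjOn (fun t : ℝ => t ^ e) (Set.Ioo (0:ℝ) ρ) :=
    Set.InjOn.mono (fun x hx => hx.1.le) (pow_left_strictMonoOn₀ he.ne').injOn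
  rw [← integrableOn_image_iff_integrableOn_abs_deriv_smul hs hf' hinj]
  refine hg.mono_set ?_
  rintro _ ⟨t, ht, rfl⟩
  exact ⟨pow_pos ht.1 e, pow_lt_one₀ ht.1.le (ht.2.trans_le hρ₁) he.ne'⟩

/-- **Integrability forces a non-negative total exponent.** If `g` is integrable on `(0, 1)` and
`g (tᵉ) = tᵐ · G t` on `(0, r)` with `G` continuous at `0` and `G 0 ≠ 0`, then `m + (e - 1) ≥ 0`:
otherwise the substituted integrand would dominate a positive multiple of `t⁻¹` near `0⁺`. [folklore] -/
theorem tame_exponent_nonneg {g G : ℝ → ℝ} {e : ℕ} {r : ℝ} {m : ℤ} (he : 0 < e) (hr : 0 < r)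
    (hg : IntegrableOn g (Set.Ioo (0:ℝ) 1)) (hG : ContinuousAt G 0) (hG0 : G 0 ≠ 0)
    (hgG : ∀ t ∈ Set.Ioo (0:ℝ) r, g (t ^ e) = t ^ m * G t) :
    0 ≤ m + ((e - 1 : ℕ) : ℤ) := by
  by_contra hneg
  push Not at hneg
  have hG0pos : 0 < |G 0| := abs_pos.mpr hG0
  have hG0abs : |G 0| ≠ 0 := hG0pos.ne'
  have hev : ∀ᶠ t in nhds (0:ℝ), |G 0| / 2 < |G t| :=
    Filter.Tendsto.eventually_const_lt (half_lt_self hG0pos) (Filter.Tendsto.abs hG)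
  obtain ⟨δ, hδ, hδG⟩ := Metric.eventually_nhds_iff.1 hev
  set ρ : ℝ := min (min r 1) δ
  have hρ : 0 < ρ := lt_min (lt_min hr one_pos) hδ
  have hρr : ρ ≤ r := (min_le_left _ _).trans (min_le_left _ _)
  have hρ1 : ρ ≤ 1 := (min_le_left _ _).trans (min_le_right _ _)
  have hρδ : ρ ≤ δ := min_le_right _ _
  have hint := tame_integrableOn_subst hg he hρ1 (ρ := ρ)
  have hte : (1:ℝ) ≤ e := by exact_mod_cast he
  apply tame_not_integrableOn_inv hρ
  refine (hint.norm.const_mul (2 / |G 0|)).mono' measurable_inv.aestronglyMeasurable ?_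
  filter_upwards [ae_restrict_mem measurableSet_Ioo] with t ht
  have ht0 : 0 < t := ht.1
  have ht1 : t ≤ 1 := (ht.2.trans_le hρ1).le
  have hGt : |G 0| / 2 ≤ |G t| := by
    refine (hδG ?_).le
    rw [Real.dist_0_eq_abs, abs_of_pos ht0]
    exact ht.2.trans_le hρδ
  have key : t⁻¹ ≤ t ^ (e - 1) * t ^ m := by
    rw [← zpow_natCast, ← zpow_add₀ ht0.ne', ← zpow_neg_one]
    exact zpow_le_zpow_right_of_le_one₀ ht0 ht1 (by omega)
  rw [hgG t ⟨ht0, ht.2.trans_le hρr⟩]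
  simp only [smul_eq_mul, Real.norm_eq_abs, abs_mul, abs_inv, abs_of_pos ht0,
    abs_of_pos (pow_pos ht0 _), abs_of_pos (zpow_pos ht0 _), Nat.abs_cast]
  calc t⁻¹ ≤ t ^ (e - 1) * t ^ m := key
    _ = 2 / |G 0| * ((1:ℝ) * (t ^ (e - 1) * t ^ m) * (|G 0| / 2)) := by
        field_simp
    _ ≤ 2 / |G 0| * ((e : ℝ) * (t ^ (e - 1) * t ^ m) * |G t|) := by gcongr
    _ = 2 / |G 0| * ((e : ℝ) * t ^ (e - 1) * (t ^ m * |G t|)) := by ring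

/-- The substituted integrand `t ↦ g (tᵉ) · e tᵉ⁻¹` is analytic at every `t₀ ∈ (0, 1]` as soon as `g`
is analytic at every point of `(0, 1]` (indeed `t₀ᵉ ∈ (0, 1]`). [folklore] -/
theorem tame_analyticAt_formula {g : ℝ → ℝ} {e : ℕ}
    (hg : ∀ s ∈ Set.Ioc (0:ℝ) 1, AnalyticAt ℝ g s) {t₀ : ℝ} (ht₀ : t₀ ∈ Set.Ioc (0:ℝ) 1) :
    AnalyticAt ℝ (fun t => g (t ^ e) * ((e : ℝ) * t ^ (e - 1))) t₀ := by
  have h1 : AnalyticAt ℝ (fun t : ℝ => t ^ e) t₀ := analyticAt_id.pow e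
  have h2 : AnalyticAt ℝ g (t₀ ^ e) := hg _ ⟨pow_pos ht₀.1 e, pow_le_one₀ ht₀.1.le ht₀.2⟩
  have h3 : AnalyticAt ℝ (fun t : ℝ => (e : ℝ) * t ^ (e - 1)) t₀ :=
    analyticAt_const.mul (analyticAt_id.pow (e - 1))
  exact (h2.fun_comp_of_eq h1 rfl).fun_mul h3

/-- **R3 (tameness at `0` after the power substitution).** If `g` is analytic at every point of `(0, 1]`,
integrable on `(0, 1)`, and has a Puiseux normal form at `0⁺` with ramification `e`, then
`t ↦ g(tᵉ) · e tᵉ⁻¹` extends to a function analytic on a neighbourhood of `[0, 1]` (integrability forces the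
Laurent exponent to be non-negative). [folklore; Kontsevich–Zagier 2001, §1.2] -/
theorem stub_tameAfterPowerSubst :
    ∀ (g : ℝ → ℝ) (e : ℕ) (r : ℝ), 0 < e → 0 < r → (∀ s ∈ Set.Ioc (0:ℝ) 1, AnalyticAt ℝ g s) → MeasureTheory.IntegrableOn g (Set.Ioo (0:ℝ) 1) → ((∀ t ∈ Set.Ioo (0:ℝ) r, g (t ^ e) = 0) ∨ ∃ (m : ℤ) (G : ℝ → ℝ), AnalyticOnNhd ℝ G (Set.Ioo (-r) r) ∧ G 0 ≠ 0 ∧ ∀ t ∈ Set.Ioo (0:ℝ) r, g (t ^ e) = t ^ m * G t) → ∃ H : ℝ → ℝ, AnalyticOnNhd ℝ H (Set.Icc (0:ℝ) 1) ∧ ∀ t ∈ Set.Ioo (0:ℝ) 1, H t = g (t ^ e) * ((e : ℝ) * t ^ (e - 1)) := by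
  intro g e r he hr hga hgi hP
  -- the cut point `c`, with `0 < c < r`
  obtain ⟨c, hc0, hcr⟩ : ∃ c : ℝ, 0 < c ∧ c < r := ⟨r / 2, half_pos hr, half_lt_self hr⟩
  have hF : ∀ t₀ ∈ Set.Ioc (0:ℝ) 1,
      AnalyticAt ℝ (fun t => g (t ^ e) * ((e : ℝ) * t ^ (e - 1))) t₀ :=
    fun t₀ ht₀ => tame_analyticAt_formula hga ht₀
  rcases hP with hzero | ⟨m, G, hGa, hG0, hgG⟩
  · -- Case A: `g (tᵉ) = 0` on `(0, r)`
    refine ⟨fun t => if t < c then 0 else g (t ^ e) * ((e : ℝ) * t ^ (e - 1)), ?_, ?_⟩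
    · intro t₀ ht₀
      by_cases h : t₀ < c
      · refine (analyticAt_const (v := (0:ℝ))).congr ?_
        filter_upwards [Iio_mem_nhds h] with t ht
        have ht' : t < c := ht
        rw [if_pos ht']
      · push Not at h
        have ht₀pos : 0 < t₀ := hc0.trans_le h
        refine (hF t₀ ⟨ht₀pos, ht₀.2⟩).congr ?_
        filter_upwards [Ioi_mem_nhds ht₀pos] with t ht
        have ht' : 0 < t := ht
        by_cases htc : t < c
        · rw [if_pos htc, hzero t ⟨ht', htc.trans hcr⟩, zero_mul]
        · rw [if_neg htc]
    · intro t ht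
      dsimp only
      by_cases htc : t < c
      · rw [if_pos htc, hzero t ⟨ht.1, htc.trans hcr⟩, zero_mul]
      · rw [if_neg htc]
  · -- Case B: `g (tᵉ) = tᵐ · G t` on `(0, r)`
    have hGc : ContinuousAt G 0 := (hGa 0 ⟨by linarith, hr⟩).continuousAt
    obtain ⟨n, hn⟩ := Int.eq_ofNat_of_zero_le (tame_exponent_nonneg he hr hgi hGc hG0 hgG)
    have hid : ∀ t : ℝ, 0 < t → t < r →
        g (t ^ e) * ((e : ℝ) * t ^ (e - 1)) = (e : ℝ) * t ^ n * G t := by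
      intro t ht htr
      rw [hgG t ⟨ht, htr⟩, ← zpow_natCast t n, ← hn, zpow_add₀ ht.ne', zpow_natCast]
      ring
    refine ⟨fun t => if t < c then (e : ℝ) * t ^ n * G t else g (t ^ e) * ((e : ℝ) * t ^ (e - 1)),
      ?_, ?_⟩
    · intro t₀ ht₀
      by_cases h : t₀ < c
      · have hA : AnalyticAt ℝ (fun t => (e : ℝ) * t ^ n * G t) t₀ := by
          have hGt₀ : AnalyticAt ℝ G t₀ := hGa t₀ ⟨by linarith [ht₀.1], h.trans hcr⟩
          exact (analyticAt_const.mul (analyticAt_id.pow n)).mul hGt₀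
        refine hA.congr ?_
        filter_upwards [Iio_mem_nhds h] with t ht
        have ht' : t < c := ht
        rw [if_pos ht']
      · push Not at h
        have ht₀pos : 0 < t₀ := hc0.trans_le h
        refine (hF t₀ ⟨ht₀pos, ht₀.2⟩).congr ?_
        filter_upwards [Ioi_mem_nhds ht₀pos] with t ht
        have ht' : 0 < t := ht
        by_cases htc : t < c
        · rw [if_pos htc, hid t ht' (htc.trans hcr)]
        · rw [if_neg htc]
    · intro t ht
      dsimp only
      by_cases htc : t < c
      · rw [if_pos htc, hid t ht.1 (htc.trans hcr)]
      · rw [if_neg htc]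

end Summit.KontsevichZagierPeriods.FurushoPentagon.SectorToKernel
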